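import Summits.QuantumFields.YangMills.Theorems.UV3AxialLaunderingTranslateSlots
import Summits.QuantumFields.YangMills.Theorems.BalabanUVNodesN08AxialLaunderingWeighted
import HarnessLib

/-!
# R3 (cell `ym3-torus`, YM₃ on T³ — a ladder RUNG, NOT d = 4, NOT infinite volume, NOT a mass gap, NOT the Clay problem) —
# **ONE ISOLATED FIRING IS INVISIBLE TWO LEVELS UP: if the step `k → k+1` is the straight transporter modified in the single coordinate `c` by a value `m(U)`, the step
# `k+1 → k+2` is the straight transporter, and the density `g` and the fired value `m` are blind to one fine bond inside some segment bond `c″ ≠ c` of every level-(k+2)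
# segment, then `(g·dU_k)∘(Ū_ax ∘ update_c m ∘ ·)⁻¹ = (∫g)•dU_{k+2}` — the (M4-core) letter (125) of the N08 seat's hTop design, with free MIDDLE slots allowed**

Width seat `ym3-torus-px8` g12 on crux `stmt-QuantumFields-19936` `UnitScaleTilt.HistoryTailL` (`--supports`, helper; THEOREMS ONLY, 0 `def`, 0 `sorry`), on `pub-ymgap-dag-n08-d` g47's
02:25Z hand-over «(125)» (my «MINE» 02:26Z).  Part (B) over the abstract core ✓`UV3AxialLaunderingTranslateSlots` (part (A)) and ✓`UV3AxialLaunderingFreeSlot` (p755566).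

THE OBJECTS (lit `AveragingRT` letters; `c : PBond P (k+1)` the fired bond; `m : GaugeField P k G → G` the fired value, e.g. `avgFun ℰ · c`; the hybrid step
`U ↦ Function.update (axialAvg U) c (m U)`; the composite `Φ U := axialAvg (update (axialAvg U) c (m U)) : GaugeField P (k+2) G`).  SLOTS: for every level-(k+2) bond `C` a position
`s C < L` with `line C (s C) ≠ c` (any bond of `C`'s segment other than the fired one — it exists as soon as `L ≥ 2`), and fine positions `t₁ : PBond P (k+1) → ℕ`, `t₁ < L` (only the
values at the slot bonds `c″ C := line C (s C)` matter: the free fine bond is `line (c″ C) (t₁ (c″ C))`).  THE SHEAR `σ_κ U := U·ext_{t₁}(ext_{c″} κ)` right-multiplies, for every `C`,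
that one fine bond by `κ C` (p755566's level-`k` slot shear with the coarse multiplier `κ` pushed down to the slot bonds and `1` elsewhere).  HYPOTHESES: `g` and `m` are blind to
`σ_κ` (for the (0.4) guard: the free fine bond lies outside the guard's read set — g47's ✓`BalabanUVNodesN08GuardReadSet` — e.g. the END of `c″` away from `c`, ✓`first_or_last_unread_of_blocks`;
the read-set form `…_of_readSet` below takes exactly that shape).

THE ARGUMENT.  The translate property of the core: `axialAvg (σ_κ U) = (A₁·ext_{c″}κ·B₁)` coordinatewise at level k+1 (✓`exists_axialAvg_shear`), so along the segment of `C` the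
hybrid field `update (axialAvg (σ_κ U)) c (m U)` has the factor `A₁(c″C)·κ C·B₁(c″C)` at position `s C` and `κ`-INDEPENDENT factors elsewhere (`m U` at the fired bond if it lies on
the segment; `A₁·1·B₁` at the other bonds, which are no slot bonds by `line_inj`); hence `Φ(σ_κ U) C = A C·κ C·B C` (§1 `exists_pathProd_single_slot`), and part (A)'s
`map_withDensity_eq_smul_of_translateSlots` concludes.  NO middle-bond exception: for `L = 3` and `c` the middle bond of `C`'s segment, `c″ C :=` an END bond of that segment is
admissible (its own far fine end is unread by the guard at `c`).

CONTENTS. §1 `exists_pathProd_single_slot` (generic: a `κ`-indexed family of fields agreeing off one position of a segment and two-sidedly translating `κ C` there has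
`pathProd = A·κ C·B`), `measurable_update_axialAvg`, `measurable_extend_slotBond`, `measurable_twoLevelShear`; §2 ★ `exists_twoLevel_translate` (the translate property of
`Φ = Ū_ax ∘ update_c m` under the two-level shear), ★★★ `map_withDensity_twoLevel_eq_smul` (the theorem), ★★★ `map_withDensity_prod_twoLevel_eq` (WITH SPECTATORS, product form:
a spectator `φ` blind to the shear is independent of the exactly-Haar level-(k+2) field), ★★ `map_withDensity_twoLevel_eq_smul_of_readSet` (`g`, `m` read only `R ⊆ PBond P k`, every
free fine bond outside `R`), ★ `map_restrict_twoLevel_eq_smul_of_readSet` (event form).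

HONEST SCOPE.  [folklore] measure∕lattice bookkeeping over parts (A) and p755566; the identification of the read set of the (0.4) guard and the choice of the slots are the N08 seat's
(✓p756298, (M3)); nothing of hTop ∕ (M4) in full (clusters, spectators across levels, KP) ∕ hJ ∕ `HistoryTailL` (19936) ∕ the rung ∕ d = 4 ∕ a mass gap ∕ Clay is proved here.  YM₃ on T³ is
rung R3 of the ladder, not the Clay problem.

References: T. Bałaban, Commun. Math. Phys. **109** (1987) 249–301 [Balaban1987RG1] ((0.4) p. 253, (0.11) p. 253); T. Bałaban, Commun. Math. Phys. **95** (1984) 17–40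
[Balaban1984PropagatorsI] ((1.7) p. 18); T. Bałaban, Commun. Math. Phys. **98** (1985) 17–51 [Balaban1985Averaging] ((10) p. 19).
-/

set_option autoImplicit false

noncomputable section

open MeasureTheory
open scoped ENNReal

namespace Summit.QuantumFields.YangMills.Theorems.UV3AxialLaunderingTwoLevelSingleFiring

open Literature.MathematicalPhysics.QuantumFieldTheory.Balaban1983to89
open Literature.MathematicalPhysics.QuantumFieldTheory.Balaban1983to89.AveragingRT
open Summit.QuantumFields.YangMills.Theorems.UV3AxialLaunderingFreeSlot
open Summit.QuantumFields.YangMills.Theorems.UV3AxialLaunderingTranslateSlots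
open Summit.QuantumFields.YangMills.Theorems.BalabanUVNodesN08AxialLaunderingWeighted (map_withDensity_eq_of_comp_eq)

/-! ## §1 Algebra and measurability -/
section Algebra

variable {P : Params} {j : ℕ} {G : Type*} [GaugeGroup G]

/-- **A SEGMENT PRODUCT WITH ONE `κ`-SLOT**: if a family of level-`j` fields `W y` takes `y`-INDEPENDENT values at the bonds `line C s′`, `s′ ≠ s₀`, of the segment of `C` and the value
`a·κ(y)·b` at `line C s₀` (`s₀ < L`), then `pathProd (W y) C L = A·κ(y)·B` for some `A`, `B`. [cite: Balaban1984PropagatorsI, (1.7) p.18] -/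
theorem exists_pathProd_single_slot {Y : Type*} (C : PBond P (j + 1)) {s₀ : ℕ} (hs₀ : s₀ < P.L) (W : Y → GaugeField P j G)
    (w : ℕ → G) (a b : G) (κ : Y → G)
    (hW : ∀ (y : Y) (s' : ℕ), s' < P.L → s' ≠ s₀ → W y (line C s') = w s')
    (hW₀ : ∀ y : Y, W y (line C s₀) = a * κ y * b) :
    ∃ A B : G, ∀ y : Y, pathProd (W y) C P.L = A * κ y * B := by
  -- before the slot the product is `y`-independent
  have hpre : ∀ n : ℕ, n ≤ s₀ → ∃ p : G, ∀ y, pathProd (W y) C n = p := by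
    intro n
    induction n with
    | zero => intro _; exact ⟨1, fun _ => rfl⟩
    | succ n ih =>
      intro hn
      obtain ⟨p, hp⟩ := ih (by omega)
      refine ⟨p * w n, fun y => ?_⟩
      simp only [pathProd, hp y, hW y n (by omega) (by omega)]
  -- from the slot on it is a two-sided translate of `κ y`
  have hpost : ∀ n : ℕ, s₀ < n → n ≤ P.L → ∃ A B : G, ∀ y, pathProd (W y) C n = A * κ y * B := by
    intro n
    induction n with
    | zero => intro h; exact absurd h (Nat.not_lt_zero _)
    | succ n ih =>
      intro hn hnL
      by_cases heq : n = s₀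
      · subst heq
        obtain ⟨p, hp⟩ := hpre n le_rfl
        refine ⟨p * a, b, fun y => ?_⟩
        simp only [pathProd, hp y, hW₀ y, mul_assoc]
      · obtain ⟨A, B, hAB⟩ := ih (by omega) (by omega)
        refine ⟨A, B * w n, fun y => ?_⟩
        simp only [pathProd, hAB y, hW y n (by omega) heq, mul_assoc]
  exact hpost P.L hs₀ le_rfl

variable [MeasurableSpace G] [MeasurableMul₂ G]

/-- The hybrid step `U ↦ update (Ū_ax U) c (m U)` is measurable for measurable `m`. [folklore] -/
theorem measurable_update_axialAvg [DecidableEq (PBond P (j + 1))] (c : PBond P (j + 1)) {m : GaugeField P j G → G} (hm : Measurable m) :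
    Measurable fun U : GaugeField P j G => Function.update (axialAvg U) c (m U) := by
  refine measurable_pi_iff.mpr fun c' => ?_
  by_cases h : c' = c
  · subst h
    simp only [Function.update_self]
    exact hm
  · simp only [Function.update_of_ne h]
    exact (measurable_pi_apply c').comp measurable_axialAvg

omit [MeasurableMul₂ G] in
/-- Pushing a coarse field down to injectively chosen bonds (and `1` elsewhere) is measurable. [folklore] -/
theorem measurable_extend_slotBond {ι : Type*} (e : ι → PBond P j) (he : Function.Injective e) :
    Measurable fun κ : ι → G => Function.extend e κ (fun _ => (1 : G)) := by
  refine measurable_pi_iff.mpr fun b => ?_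
  by_cases hb : ∃ i, e i = b
  · obtain ⟨i, rfl⟩ := hb
    simp only [he.extend_apply]
    exact measurable_pi_apply i
  · simp only [Function.extend_apply' _ _ _ hb]
    exact measurable_const

end Algebra

/-! ## §2 The two-level laundering of one isolated firing -/
section TwoLevel

variable {P : Params} {k : ℕ} {G : Type*} [GaugeGroup G] [MeasurableSpace G] [HaarData G] [MeasurableMul₂ G]
  [DecidableEq (PBond P (k + 1))]

omit [HaarData G] [DecidableEq (PBond P (k + 1))] in
/-- The two-level slot shear `(U, κ) ↦ U·ext_{t₁}(ext_{c″} κ)` is jointly measurable. [folklore] -/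
theorem measurable_twoLevelShear (hk : k + 1 ≤ P.m + P.K) (hk' : k + 1 + 1 ≤ P.m + P.K)
    (s : PBond P (k + 1 + 1) → ℕ) (hs : ∀ C, s C < P.L) (t₁ : PBond P (k + 1) → ℕ) (ht₁ : ∀ c', t₁ c' < P.L) :
    Measurable fun p : GaugeField P k G × GaugeField P (k + 1 + 1) G => fun b =>
      p.1 b * Function.extend (fun c' : PBond P (k + 1) => line c' (t₁ c'))
        (Function.extend (fun C : PBond P (k + 1 + 1) => line C (s C)) p.2 (fun _ => (1 : G))) (fun _ => 1) b := by
  have h1 : Measurable fun κ : GaugeField P (k + 1 + 1) G =>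
      Function.extend (fun C : PBond P (k + 1 + 1) => line C (s C)) κ (fun _ => (1 : G)) :=
    measurable_extend_slotBond _ (slot_injective hk' s hs)
  exact (measurable_shear (G := G) hk t₁ ht₁).comp (measurable_fst.prodMk (h1.comp measurable_snd))

omit [MeasurableSpace G] [HaarData G] [MeasurableMul₂ G] in
/-- ★ **THE TWO-LEVEL TRANSLATE PROPERTY**: for fixed `U`, the composite `Φ = Ū_ax ∘ update_c m` turns the two-level shear `σ_κ` into a two-sided coordinatewise translate of `κ`:
`Φ(σ_κ U) = (A_C·κ_C·B_C)_C` — along `C`'s segment the hybrid field has the factor `A₁(c″C)·κ C·B₁(c″C)` at position `s C` (✓`exists_axialAvg_shear` at level `k` with the pushed-down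
multiplier), the `κ`-free `m(U)` at the fired bond and `A₁·1·B₁` elsewhere (§1 `exists_pathProd_single_slot`). [cite: Balaban1987RG1, (0.4) + (0.11) p.253] -/
theorem exists_twoLevel_translate (hk : k + 1 ≤ P.m + P.K) (hk' : k + 1 + 1 ≤ P.m + P.K) (c : PBond P (k + 1))
    (m : GaugeField P k G → G)
    (s : PBond P (k + 1 + 1) → ℕ) (hs : ∀ C, s C < P.L) (hsc : ∀ C, line C (s C) ≠ c)
    (t₁ : PBond P (k + 1) → ℕ) (ht₁ : ∀ c', t₁ c' < P.L)
    (hmσ : ∀ (κ : GaugeField P (k + 1 + 1) G) (U : GaugeField P k G),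
      m (fun b => U b * Function.extend (fun c' : PBond P (k + 1) => line c' (t₁ c'))
        (Function.extend (fun C : PBond P (k + 1 + 1) => line C (s C)) κ (fun _ => (1 : G))) (fun _ => 1) b) = m U)
    (U : GaugeField P k G) :
    ∃ A B : GaugeField P (k + 1 + 1) G, ∀ κ : GaugeField P (k + 1 + 1) G,
      axialAvg (Function.update (axialAvg (fun b => U b *
          Function.extend (fun c' : PBond P (k + 1) => line c' (t₁ c'))
            (Function.extend (fun C : PBond P (k + 1 + 1) => line C (s C)) κ (fun _ => (1 : G))) (fun _ => 1) b)) c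
          (m (fun b => U b *
          Function.extend (fun c' : PBond P (k + 1) => line c' (t₁ c'))
            (Function.extend (fun C : PBond P (k + 1 + 1) => line C (s C)) κ (fun _ => (1 : G))) (fun _ => 1) b))) =
        fun C => A C * κ C * B C := by
  have hinj : Function.Injective (fun C : PBond P (k + 1 + 1) => line C (s C)) := slot_injective hk' s hs
  obtain ⟨A₁, B₁, hAB⟩ := exists_axialAvg_shear (G := G) hk t₁ ht₁ U
  have key : ∀ C : PBond P (k + 1 + 1), ∃ A B : G, ∀ κ : GaugeField P (k + 1 + 1) G,
      pathProd (Function.update (axialAvg (fun b => U b *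
          Function.extend (fun c' : PBond P (k + 1) => line c' (t₁ c'))
            (Function.extend (fun C : PBond P (k + 1 + 1) => line C (s C)) κ (fun _ => (1 : G))) (fun _ => 1) b)) c
          (m (fun b => U b *
          Function.extend (fun c' : PBond P (k + 1) => line c' (t₁ c'))
            (Function.extend (fun C : PBond P (k + 1 + 1) => line C (s C)) κ (fun _ => (1 : G))) (fun _ => 1) b)))
        C P.L = A * κ C * B := by
    intro C
    refine exists_pathProd_single_slot C (hs C) _
      (fun s' => if line C s' = c then m U else A₁ (line C s') * B₁ (line C s')) (A₁ (line C (s C))) (B₁ (line C (s C)))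
      (fun κ : GaugeField P (k + 1 + 1) G => κ C) (fun κ s' hs' hne => ?_) (fun κ => ?_)
    · by_cases hcs : line C s' = c
      · rw [hcs, Function.update_self, if_pos rfl]
        exact hmσ κ U
      · rw [Function.update_of_ne hcs, hAB, if_neg hcs]
        have hnot : ¬ ∃ C', line C' (s C') = line C s' := by
          rintro ⟨C', hC'⟩
          obtain ⟨rfl, hss⟩ := line_inj hk' (hs C') hs' hC'
          exact hne hss.symm
        simp only [Function.extend_apply' _ _ _ hnot, mul_one]
    · rw [Function.update_of_ne (hsc C), hAB]
      simp only [hinj.extend_apply]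
  choose A B hAB' using key
  refine ⟨A, B, fun κ => ?_⟩
  funext C
  exact hAB' C κ

/-- ★★★ **ONE ISOLATED FIRING IS INVISIBLE TWO LEVELS UP.**  Standing range `k + 2 ≤ m + K`; fired bond `c : PBond P (k+1)`, fired value `m` (measurable); slots `s C < L` with
`line C (s C) ≠ c` and fine positions `t₁ < L`; the density `g ≥ 0` (measurable) and `m` blind to the two-level shear `σ_κ`.  Then
`((dU_k).withDensity g).map (U ↦ Ū_ax (update (Ū_ax U) c (m U))) = (∫⁻ g dU_k) • dU_{k+2}`.
[cite: Balaban1987RG1, (0.4) + (0.11) p.253; Balaban1985Averaging, (10) p.19] -/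
theorem map_withDensity_twoLevel_eq_smul (hk : k + 1 ≤ P.m + P.K) (hk' : k + 1 + 1 ≤ P.m + P.K) (c : PBond P (k + 1))
    {m : GaugeField P k G → G} (hm : Measurable m)
    (s : PBond P (k + 1 + 1) → ℕ) (hs : ∀ C, s C < P.L) (hsc : ∀ C, line C (s C) ≠ c)
    (t₁ : PBond P (k + 1) → ℕ) (ht₁ : ∀ c', t₁ c' < P.L)
    {g : GaugeField P k G → ℝ≥0∞} (hg : Measurable g)
    (hgσ : ∀ (κ : GaugeField P (k + 1 + 1) G) (U : GaugeField P k G),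
      g (fun b => U b * Function.extend (fun c' : PBond P (k + 1) => line c' (t₁ c'))
        (Function.extend (fun C : PBond P (k + 1 + 1) => line C (s C)) κ (fun _ => (1 : G))) (fun _ => 1) b) = g U)
    (hmσ : ∀ (κ : GaugeField P (k + 1 + 1) G) (U : GaugeField P k G),
      m (fun b => U b * Function.extend (fun c' : PBond P (k + 1) => line c' (t₁ c'))
        (Function.extend (fun C : PBond P (k + 1 + 1) => line C (s C)) κ (fun _ => (1 : G))) (fun _ => 1) b) = m U) :
    ((fieldMeasure P k G).withDensity g).map
        (fun U : GaugeField P k G => axialAvg (Function.update (axialAvg U) c (m U))) =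
      (∫⁻ U, g U ∂(fieldMeasure P k G)) • fieldMeasure P (k + 1 + 1) G :=
  map_withDensity_eq_smul_of_translateSlots (fieldMeasure P k G) _
    (measurable_axialAvg.comp (measurable_update_axialAvg c hm)) _ (measurable_twoLevelShear hk hk' s hs t₁ ht₁)
    (fun _ => measurePreserving_mulRight _) (exists_twoLevel_translate hk hk' c m s hs hsc t₁ ht₁ hmσ) hg hgσ

/-- ★★★ **… WITH SPECTATORS, IN PRODUCT FORM**: if moreover a measurable spectator `φ : GaugeField P k G → Y` is blind to the two-level shear and `∫g < ∞`, then
`((dU_k).withDensity g).map (U ↦ (φ U, Ū_ax (update (Ū_ax U) c (m U)))) = (((dU_k).withDensity g).map φ) ⊗ dU_{k+2}` — the level-(k+2) field is exactly Haar AND independent of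
the spectator (part (A)'s `map_prod_eq_of_translateSlots`). [cite: Balaban1987RG1, (0.4) + (0.11) p.253; Balaban1985Averaging, (10) p.19] -/
theorem map_withDensity_prod_twoLevel_eq {Y : Type*} [MeasurableSpace Y]
    (hk : k + 1 ≤ P.m + P.K) (hk' : k + 1 + 1 ≤ P.m + P.K) (c : PBond P (k + 1))
    {m : GaugeField P k G → G} (hm : Measurable m)
    (s : PBond P (k + 1 + 1) → ℕ) (hs : ∀ C, s C < P.L) (hsc : ∀ C, line C (s C) ≠ c)
    (t₁ : PBond P (k + 1) → ℕ) (ht₁ : ∀ c', t₁ c' < P.L)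
    {g : GaugeField P k G → ℝ≥0∞} (hg : Measurable g) (hfin : ∫⁻ U, g U ∂(fieldMeasure P k G) ≠ ∞)
    {φ : GaugeField P k G → Y} (hφ : Measurable φ)
    (hgσ : ∀ (κ : GaugeField P (k + 1 + 1) G) (U : GaugeField P k G),
      g (fun b => U b * Function.extend (fun c' : PBond P (k + 1) => line c' (t₁ c'))
        (Function.extend (fun C : PBond P (k + 1 + 1) => line C (s C)) κ (fun _ => (1 : G))) (fun _ => 1) b) = g U)
    (hmσ : ∀ (κ : GaugeField P (k + 1 + 1) G) (U : GaugeField P k G),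
      m (fun b => U b * Function.extend (fun c' : PBond P (k + 1) => line c' (t₁ c'))
        (Function.extend (fun C : PBond P (k + 1 + 1) => line C (s C)) κ (fun _ => (1 : G))) (fun _ => 1) b) = m U)
    (hφσ : ∀ (κ : GaugeField P (k + 1 + 1) G) (U : GaugeField P k G),
      φ (fun b => U b * Function.extend (fun c' : PBond P (k + 1) => line c' (t₁ c'))
        (Function.extend (fun C : PBond P (k + 1 + 1) => line C (s C)) κ (fun _ => (1 : G))) (fun _ => 1) b) = φ U) :
    ((fieldMeasure P k G).withDensity g).map
        (fun U : GaugeField P k G => (φ U, axialAvg (Function.update (axialAvg U) c (m U)))) =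
      (((fieldMeasure P k G).withDensity g).map φ).prod (fieldMeasure P (k + 1 + 1) G) := by
  haveI : IsFiniteMeasure ((fieldMeasure P k G).withDensity g) := isFiniteMeasure_withDensity hfin
  -- the weighted measure is invariant under the (measure-preserving, `g`-fixing) shears
  have hinv : ∀ κ : GaugeField P (k + 1 + 1) G,
      ((fieldMeasure P k G).withDensity g).map (fun U : GaugeField P k G => fun b => U b *
        Function.extend (fun c' : PBond P (k + 1) => line c' (t₁ c'))
          (Function.extend (fun C : PBond P (k + 1 + 1) => line C (s C)) κ (fun _ => (1 : G))) (fun _ => 1) b) =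
        (fieldMeasure P k G).withDensity g := by
    intro κ
    exact map_withDensity_eq_of_comp_eq (measurePreserving_mulRight _) hg fun U => hgσ κ U
  exact map_prod_eq_of_translateSlots ((fieldMeasure P k G).withDensity g) _
    (measurable_axialAvg.comp (measurable_update_axialAvg c hm)) _ (measurable_twoLevelShear hk hk' s hs t₁ ht₁)
    hinv (exists_twoLevel_translate hk hk' c m s hs hsc t₁ ht₁ hmσ) hφ hφσ

/-- ★★ **READ-SET FORM**: if `g` and `m` read only the fine bonds of `R ⊆ PBond P k` and every free fine bond `line (line C (s C)) (t₁ (line C (s C)))` lies outside `R`, the blindness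
hypotheses hold and the single firing is invisible two levels up. (For the (0.4) guard at `c`: `R = R(c)` of g47's ✓`…N08GuardReadSet`, the free fine bond the END of `c″ ≠ c` away
from `c`, ✓`first_or_last_unread_of_blocks`.) [cite: Balaban1987RG1, (0.4) + (0.11) p.253; Balaban1985Averaging, (10) p.19] -/
theorem map_withDensity_twoLevel_eq_smul_of_readSet (hk : k + 1 ≤ P.m + P.K) (hk' : k + 1 + 1 ≤ P.m + P.K) (c : PBond P (k + 1))
    {m : GaugeField P k G → G} (hm : Measurable m)
    (s : PBond P (k + 1 + 1) → ℕ) (hs : ∀ C, s C < P.L) (hsc : ∀ C, line C (s C) ≠ c)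
    (t₁ : PBond P (k + 1) → ℕ) (ht₁ : ∀ c', t₁ c' < P.L)
    {g : GaugeField P k G → ℝ≥0∞} (hg : Measurable g) (R : Set (PBond P k))
    (hgR : ∀ U U' : GaugeField P k G, (∀ b ∈ R, U b = U' b) → g U = g U')
    (hmR : ∀ U U' : GaugeField P k G, (∀ b ∈ R, U b = U' b) → m U = m U')
    (hfree : ∀ C : PBond P (k + 1 + 1), line (line C (s C)) (t₁ (line C (s C))) ∉ R) :
    ((fieldMeasure P k G).withDensity g).map
        (fun U : GaugeField P k G => axialAvg (Function.update (axialAvg U) c (m U))) =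
      (∫⁻ U, g U ∂(fieldMeasure P k G)) • fieldMeasure P (k + 1 + 1) G := by
  have hinj : Function.Injective (fun C : PBond P (k + 1 + 1) => line C (s C)) := slot_injective hk' s hs
  -- the shear does not move the bonds of `R`
  have hagree : ∀ (κ : GaugeField P (k + 1 + 1) G) (U : GaugeField P k G), ∀ b ∈ R,
      U b * Function.extend (fun c' : PBond P (k + 1) => line c' (t₁ c'))
        (Function.extend (fun C : PBond P (k + 1 + 1) => line C (s C)) κ (fun _ => (1 : G))) (fun _ => 1) b = U b := by
    intro κ U b hb
    by_cases h1 : ∃ c', line c' (t₁ c') = b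
    · obtain ⟨c', rfl⟩ := h1
      rw [extend_slot_apply hk t₁ ht₁]
      by_cases h2 : ∃ C, line C (s C) = c'
      · obtain ⟨C, rfl⟩ := h2
        exact absurd hb (hfree C)
      · rw [Function.extend_apply' _ _ _ h2, mul_one]
    · rw [Function.extend_apply' _ _ _ h1, mul_one]
  exact map_withDensity_twoLevel_eq_smul hk hk' c hm s hs hsc t₁ ht₁ hg (fun κ U => hgR _ _ (hagree κ U))
    (fun κ U => hmR _ _ (hagree κ U))

/-- ★ **EVENT FORM**: for an event `E` and a fired value `m` determined by the bonds of `R`, every free fine bond outside `R`: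
`(dU_k↾E).map (U ↦ Ū_ax (update (Ū_ax U) c (m U))) = dU_k(E) • dU_{k+2}`. [folklore] -/
theorem map_restrict_twoLevel_eq_smul_of_readSet (hk : k + 1 ≤ P.m + P.K) (hk' : k + 1 + 1 ≤ P.m + P.K) (c : PBond P (k + 1))
    {m : GaugeField P k G → G} (hm : Measurable m)
    (s : PBond P (k + 1 + 1) → ℕ) (hs : ∀ C, s C < P.L) (hsc : ∀ C, line C (s C) ≠ c)
    (t₁ : PBond P (k + 1) → ℕ) (ht₁ : ∀ c', t₁ c' < P.L)
    {E : Set (GaugeField P k G)} (hE : MeasurableSet E) (R : Set (PBond P k))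
    (hER : ∀ U U' : GaugeField P k G, (∀ b ∈ R, U b = U' b) → (U ∈ E ↔ U' ∈ E))
    (hmR : ∀ U U' : GaugeField P k G, (∀ b ∈ R, U b = U' b) → m U = m U')
    (hfree : ∀ C : PBond P (k + 1 + 1), line (line C (s C)) (t₁ (line C (s C))) ∉ R) :
    ((fieldMeasure P k G).restrict E).map
        (fun U : GaugeField P k G => axialAvg (Function.update (axialAvg U) c (m U))) =
      (fieldMeasure P k G E) • fieldMeasure P (k + 1 + 1) G := by
  classical
  have hind : ∀ U U' : GaugeField P k G, (∀ b ∈ R, U b = U' b) →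
      E.indicator (1 : GaugeField P k G → ℝ≥0∞) U = E.indicator (1 : GaugeField P k G → ℝ≥0∞) U' := by
    intro U U' h
    by_cases hU : U ∈ E
    · have hU' : U' ∈ E := (hER U U' h).1 hU
      simp only [Set.indicator, hU, hU', if_true, Pi.one_apply]
    · have hU' : U' ∉ E := fun h' => hU ((hER U U' h).2 h')
      simp only [Set.indicator, hU, hU', if_false]
  rw [← withDensity_indicator_one hE,
    map_withDensity_twoLevel_eq_smul_of_readSet hk hk' c hm s hs hsc t₁ ht₁ (measurable_one.indicator hE) R hind hmR hfree,
    lintegral_indicator_one hE]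

end TwoLevel

end Summit.QuantumFields.YangMills.Theorems.UV3AxialLaunderingTwoLevelSingleFiring

end
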